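import Summits.AtomisticToContinuum.FouriersLaw.Theorems.JunctionLocalityNonBallisticLightConeAssemblyPart2f

/-!
# Space-time bond-current correlations of the open pinned chain from single momentum flips (light cone of (C′), kernel level)

Helper (`--supports stmt-AtomisticToContinuum-14013`) for the line `series-law-at-every-laplace-frequency`
(SketchIdeator2) of the crux `LatticeLandauDamping.AbelThermodynamicLimit`, stub (C′)
`stub_uniformAnchoredCorrelationTails`. Registered sub-goal `pinnedChain_sq_pairCorrelation_le_of_singleFlips`.

For `P = pinnedChain ω₂ lam β γ` (all `> 0`), `T > 0`, `μ_T = gibbsMeasure N T`, `κ_s = transitionKernel N T T s`,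
an anchor bond `(i, i+1)` and a target bond `(k, k+1)`, the equilibrium space-time correlation
`⟨j_i(0) j_k(s)⟩_{N,T} = ∫ j_i · κ_s j_k dμ_T` is controlled by the SYNCHRONOUS COUPLING of two strong solutions
driven by the same Brownian pair from `x` and from `x` with ONE momentum flipped:

  `(∫ j_i · κ_s j_k dμ_T)² ≤ ¼ (∫ j_i² dμ_T) · (2B₁ + 2B₂)`

whenever `E_{μ_T ⊗ W}[(j_k(Φ_s(Θ_{i+1}x)) − j_k(Φ_s x))²] ≤ B₁` and `E_{μ_T ⊗ W}[(j_k(Φ_s(Θ_i x)) − j_k(Φ_s x))²] ≤ B₂`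
(Lebesgue form). Mechanism (the odd-pairing calculus of the landed `NonBallistic` light-cone window, now at an
arbitrary anchor): the two-momenta flip `Θ_iΘ_{i+1}` preserves `μ_T`, is an involution, and NEGATES `j_i` while the
far current does not see it at time `0`; the pairing bound `4(∫ j_i h)² ≤ ∫ j_i² · ∫ (h − h∘Θ_iΘ_{i+1})²`
(`four_mul_sq_integral_le`), Jensen in the noise (`sq_kernel_sub_le_integral_sq`) and the triangle inequality through
the intermediate start `Θ_{i+1}x ∼ μ_T`. Folklore; no definitions.
-/

noncomputable section

open MeasureTheory ProbabilityTheory Set Filter Topology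
open scoped NNReal ENNReal

namespace Summit.AtomisticToContinuum.FouriersLaw.Theorems.AbelThermodynamicLimit.SeriesLawAtEveryLaplaceFrequency

open Literature.MathematicalPhysics.KineticTheory Literature.MathematicalPhysics.KineticTheory.HeatConduction
open Literature.Probability.Process OscillatorChain
open Summit.AtomisticToContinuum.FouriersLaw.Theorems.NonBallistic
open Summit.AtomisticToContinuum.FouriersLaw.Theorems.NonBallistic.FSAssembly
open Summit.AtomisticToContinuum.FouriersLaw.Theorems.OddResponseBound.Negative.OddPairing (four_mul_sq_integral_le)
open Summit.AtomisticToContinuum.FouriersLaw.Theorems.SubdiffusiveBondHeat (pinnedChain_integral_sq_act_le)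
open Summit.AtomisticToContinuum.FouriersLaw.Theorems.LightConeBondHeat (pinnedChain_abs_bondCurrent_le_exp
  quarter_inv_temp_admissible)

namespace FlipReduction

variable {N : ℕ}

/-- The anchor current `j_i = -½(p_i + p_{i+1})V'(q_{i+1} - q_i)` is ODD under the flip of its two momenta.
[folklore] -/
theorem bondCurrent_anchorFlip (P : OscillatorChain) (i i' : Fin N) (hi' : (i' : ℕ) = (i : ℕ) + 1)
    (x : PhaseSpace N) :
    P.bondCurrent N i (momentumFlip i (momentumFlip i' x)) = -P.bondCurrent N i x := by
  -- adapted from `NonBallistic.bondCurrent_zero_contactFlip` (anchor `i = 0` there)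
  have hne : i ≠ i' := fun h => by rw [h] at hi'; omega
  have hne' : i' ≠ i := fun h => hne h.symm
  simp only [OscillatorChain.bondCurrent, momentumFlip_fst, ← Finset.sum_neg_distrib]
  refine Finset.sum_congr rfl fun j _ => ?_
  by_cases h : (j : ℕ) = (i : ℕ) + 1
  · have hj : j = i' := Fin.ext (by omega)
    subst hj
    rw [if_pos h, if_pos h, momentumFlip_snd_self, momentumFlip_snd_of_ne hne, momentumFlip_snd_of_ne hne',
      momentumFlip_snd_self]
    ring
  · rw [if_neg h, if_neg h, neg_zero]

variable {ω₂ lam β γ : ℝ} (hω : 0 < ω₂) (hl : 0 < lam) (hβ : 0 < β) (hγ : 0 < γ) {T : ℝ} (hT : 0 < T)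

include hω hl hβ hγ hT in
/-- **Kernel level from pathwise level** (Jensen in the noise): for any two measurable start maps... here for the
double flip: `∫ (κ_s j_k(x) − κ_s j_k(Θ_iΘ_{i'}x))² dμ_T ≤ B` as soon as the Lebesgue pathwise mean square of the
synchronous coupling is `≤ B`. [folklore] -/
theorem integral_sq_kernel_sub_le (i i' k : Fin N) (s : ℝ≥0) {B : ℝ} (hB : 0 ≤ B)
    (hpath : ∫⁻ x, ∫⁻ ω, ENNReal.ofReal
        (((pinnedChain ω₂ lam β γ).bondCurrent N k ((pinnedChain ω₂ lam β γ).solMap N T T s x (pairPath ω)) -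
          (pinnedChain ω₂ lam β γ).bondCurrent N k
            ((pinnedChain ω₂ lam β γ).solMap N T T s (momentumFlip i (momentumFlip i' x)) (pairPath ω))) ^ 2)
        ∂wienerPair ∂((pinnedChain ω₂ lam β γ).gibbsMeasure N T) ≤ ENNReal.ofReal B) :
    ∫ x, ((∫ y, (pinnedChain ω₂ lam β γ).bondCurrent N k y ∂((pinnedChain ω₂ lam β γ).transitionKernel N T T s x)) -
        ∫ y, (pinnedChain ω₂ lam β γ).bondCurrent N k y
          ∂((pinnedChain ω₂ lam β γ).transitionKernel N T T s (momentumFlip i (momentumFlip i' x)))) ^ 2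
      ∂((pinnedChain ω₂ lam β γ).gibbsMeasure N T) ≤ B := by
  -- adapted from `NonBallistic.flipInsensitivity_of_pathwise`
  have hN0 : 0 < N := k.pos
  set P := pinnedChain ω₂ lam β γ with hP
  set μ := P.gibbsMeasure N T with hμ
  set F : PhaseSpace N → ℝ := fun x =>
    ((∫ y, P.bondCurrent N k y ∂(P.transitionKernel N T T s x)) -
      ∫ y, P.bondCurrent N k y ∂(P.transitionKernel N T T s (momentumFlip i (momentumFlip i' x)))) ^ 2 with hF
  have hF0 : ∀ x, 0 ≤ F x := fun x => sq_nonneg _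
  have hpt : ∀ x, ENNReal.ofReal (F x) ≤ ∫⁻ ω, ENNReal.ofReal
      ((P.bondCurrent N k (P.solMap N T T s x (pairPath ω)) -
        P.bondCurrent N k (P.solMap N T T s (momentumFlip i (momentumFlip i' x)) (pairPath ω))) ^ 2) ∂wienerPair := by
    intro x
    refine le_trans (ENNReal.ofReal_le_ofReal
      (sq_kernel_sub_le_integral_sq hω hl.le hβ hγ hN0 hT k s x (momentumFlip i (momentumFlip i' x)))) ?_
    exact ProfileAntitone.ofReal_integral_le_lintegral_ofReal' (ae_of_all _ fun _ => sq_nonneg _)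
  show ∫ x, F x ∂μ ≤ B
  by_cases hint : Integrable F μ
  · have h1 : ENNReal.ofReal (∫ x, F x ∂μ) ≤ ENNReal.ofReal B :=
      calc ENNReal.ofReal (∫ x, F x ∂μ) = ∫⁻ x, ENNReal.ofReal (F x) ∂μ :=
            ofReal_integral_eq_lintegral_ofReal hint (ae_of_all _ hF0)
        _ ≤ _ := lintegral_mono hpt
        _ ≤ ENNReal.ofReal B := hpath
    exact (ENNReal.ofReal_le_ofReal_iff hB).1 h1
  · rw [integral_undef hint]
    exact hB

include hω hl hβ hγ in
/-- **Double flip from two single flips** (triangle inequality; the intermediate start `Θ_{i'}x` is again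
Gibbs-distributed): in Lebesgue form,
`E[(j_k(Φ x) − j_k(Φ(Θ_iΘ_{i'}x)))²] ≤ 2E[(j_k(Φ(Θ_{i'}x)) − j_k(Φ x))²] + 2E[(j_k(Φ(Θ_i x)) − j_k(Φ x))²]`.
[folklore] -/
theorem lintegral_doubleFlip_le (i i' k : Fin N) (s : ℝ≥0) :
    ∫⁻ x, ∫⁻ ω, ENNReal.ofReal
        (((pinnedChain ω₂ lam β γ).bondCurrent N k ((pinnedChain ω₂ lam β γ).solMap N T T s x (pairPath ω)) -
          (pinnedChain ω₂ lam β γ).bondCurrent N k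
            ((pinnedChain ω₂ lam β γ).solMap N T T s (momentumFlip i (momentumFlip i' x)) (pairPath ω))) ^ 2)
        ∂wienerPair ∂((pinnedChain ω₂ lam β γ).gibbsMeasure N T) ≤
      2 * ∫⁻ x, ∫⁻ ω, ENNReal.ofReal
        (((pinnedChain ω₂ lam β γ).bondCurrent N k
            ((pinnedChain ω₂ lam β γ).solMap N T T s (momentumFlip i' x) (pairPath ω)) -
          (pinnedChain ω₂ lam β γ).bondCurrent N k ((pinnedChain ω₂ lam β γ).solMap N T T s x (pairPath ω))) ^ 2)
        ∂wienerPair ∂((pinnedChain ω₂ lam β γ).gibbsMeasure N T) +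
      2 * ∫⁻ x, ∫⁻ ω, ENNReal.ofReal
        (((pinnedChain ω₂ lam β γ).bondCurrent N k
            ((pinnedChain ω₂ lam β γ).solMap N T T s (momentumFlip i x) (pairPath ω)) -
          (pinnedChain ω₂ lam β γ).bondCurrent N k ((pinnedChain ω₂ lam β γ).solMap N T T s x (pairPath ω))) ^ 2)
        ∂wienerPair ∂((pinnedChain ω₂ lam β γ).gibbsMeasure N T) := by
  -- adapted from `NonBallistic.FSAssembly.pathwise_flipInsensitivity_of_fourthMoment`
  set P := pinnedChain ω₂ lam β γ with hP
  set μ := P.gibbsMeasure N T with hμ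
  set J : PhaseSpace N × WienerPair → ℝ := fun q => P.bondCurrent N k (P.solMap N T T s q.1 (pairPath q.2)) with hJ
  set F₁ : PhaseSpace N × WienerPair → ℝ≥0∞ := fun q =>
    ENNReal.ofReal ((J (momentumFlip i' q.1, q.2) - J q) ^ 2) with hF₁
  set F₀ : PhaseSpace N × WienerPair → ℝ≥0∞ := fun q =>
    ENNReal.ofReal ((J (momentumFlip i q.1, q.2) - J q) ^ 2) with hF₀
  have hF₁m : Measurable F₁ := FSAssembly.measurable_flipDiff_sq hω hl hβ hγ i' k s
  have hF₀m : Measurable F₀ := FSAssembly.measurable_flipDiff_sq hω hl hβ hγ i k s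
  have hΘ'm : Measurable fun q : PhaseSpace N × WienerPair => (momentumFlip i' q.1, q.2) :=
    ((measurable_momentumFlip i').comp measurable_fst).prodMk measurable_snd
  have hpt : ∀ x ω, ENNReal.ofReal ((J (x, ω) - J (momentumFlip i (momentumFlip i' x), ω)) ^ 2) ≤
      2 * F₁ (x, ω) + 2 * F₀ (momentumFlip i' x, ω) := by
    intro x ω
    simp only [hF₁, hF₀]
    set a := J (x, ω); set b := J (momentumFlip i' x, ω); set c := J (momentumFlip i (momentumFlip i' x), ω)
    have e : (a - c) ^ 2 ≤ 2 * (b - a) ^ 2 + 2 * (c - b) ^ 2 := by nlinarith [sq_nonneg (a - 2 * b + c)]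
    calc ENNReal.ofReal ((a - c) ^ 2) ≤ ENNReal.ofReal (2 * (b - a) ^ 2 + 2 * (c - b) ^ 2) := ENNReal.ofReal_le_ofReal e
      _ = 2 * ENNReal.ofReal ((b - a) ^ 2) + 2 * ENNReal.ofReal ((c - b) ^ 2) := by
          rw [ENNReal.ofReal_add (by positivity) (by positivity), ENNReal.ofReal_mul (by norm_num),
            ENNReal.ofReal_mul (by norm_num), ENNReal.ofReal_ofNat]
  have hinner : ∀ x, ∫⁻ ω, (2 * F₁ (x, ω) + 2 * F₀ (momentumFlip i' x, ω)) ∂wienerPair =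
      2 * ∫⁻ ω, F₁ (x, ω) ∂wienerPair + 2 * ∫⁻ ω, F₀ (momentumFlip i' x, ω) ∂wienerPair := by
    intro x
    have m1 : Measurable fun ω => F₁ (x, ω) := hF₁m.comp measurable_prodMk_left
    have m0 : Measurable fun ω => F₀ (momentumFlip i' x, ω) := hF₀m.comp measurable_prodMk_left
    rw [lintegral_add_left (m1.const_mul 2), lintegral_const_mul 2 m1, lintegral_const_mul 2 m0]
  have hG₁m : Measurable fun x => ∫⁻ ω, F₁ (x, ω) ∂wienerPair := hF₁m.lintegral_prod_right'
  have hG₀m : Measurable fun y => ∫⁻ ω, F₀ (y, ω) ∂wienerPair := hF₀m.lintegral_prod_right'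
  have hG₀Θm : Measurable fun x => ∫⁻ ω, F₀ (momentumFlip i' x, ω) ∂wienerPair := by
    have h := hG₀m.comp (measurable_momentumFlip i')
    exact h
  have hflip : ∫⁻ x, ∫⁻ ω, F₀ (momentumFlip i' x, ω) ∂wienerPair ∂μ = ∫⁻ x, ∫⁻ ω, F₀ (x, ω) ∂wienerPair ∂μ :=
    lintegral_comp_momentumFlip_gibbs P N T i' hG₀m
  calc ∫⁻ x, ∫⁻ ω, ENNReal.ofReal ((J (x, ω) - J (momentumFlip i (momentumFlip i' x), ω)) ^ 2) ∂wienerPair ∂μ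
      ≤ ∫⁻ x, ∫⁻ ω, (2 * F₁ (x, ω) + 2 * F₀ (momentumFlip i' x, ω)) ∂wienerPair ∂μ :=
        lintegral_mono fun x => lintegral_mono fun ω => hpt x ω
    _ = ∫⁻ x, (2 * ∫⁻ ω, F₁ (x, ω) ∂wienerPair + 2 * ∫⁻ ω, F₀ (momentumFlip i' x, ω) ∂wienerPair) ∂μ :=
        lintegral_congr hinner
    _ = 2 * ∫⁻ x, ∫⁻ ω, F₁ (x, ω) ∂wienerPair ∂μ + 2 * ∫⁻ x, ∫⁻ ω, F₀ (momentumFlip i' x, ω) ∂wienerPair ∂μ := by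
        rw [lintegral_add_left (hG₁m.const_mul 2), lintegral_const_mul 2 hG₁m, lintegral_const_mul 2 hG₀Θm]
    _ = 2 * ∫⁻ x, ∫⁻ ω, F₁ (x, ω) ∂wienerPair ∂μ + 2 * ∫⁻ x, ∫⁻ ω, F₀ (x, ω) ∂wienerPair ∂μ := by rw [hflip]

include hω hl hβ hγ hT in
/-- **The pair correlation from two single flips.** For an anchor bond `(i, i+1)` and any `k`, `s`: if the
Lebesgue pathwise mean squares of the single flips at `i+1` and at `i` are `≤ B₁`, `≤ B₂`, then
`(∫ j_i · κ_s j_k dμ_T)² ≤ ¼ (∫ j_i² dμ_T)(2B₁ + 2B₂)`. [folklore] -/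
theorem sq_pairCorrelation_le (i i' k : Fin N) (hi' : (i' : ℕ) = (i : ℕ) + 1) (s : ℝ≥0) {B₁ B₂ : ℝ}
    (hB₁ : 0 ≤ B₁) (hB₂ : 0 ≤ B₂)
    (h₁ : ∫⁻ x, ∫⁻ ω, ENNReal.ofReal
        (((pinnedChain ω₂ lam β γ).bondCurrent N k
            ((pinnedChain ω₂ lam β γ).solMap N T T s (momentumFlip i' x) (pairPath ω)) -
          (pinnedChain ω₂ lam β γ).bondCurrent N k ((pinnedChain ω₂ lam β γ).solMap N T T s x (pairPath ω))) ^ 2)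
        ∂wienerPair ∂((pinnedChain ω₂ lam β γ).gibbsMeasure N T) ≤ ENNReal.ofReal B₁)
    (h₂ : ∫⁻ x, ∫⁻ ω, ENNReal.ofReal
        (((pinnedChain ω₂ lam β γ).bondCurrent N k
            ((pinnedChain ω₂ lam β γ).solMap N T T s (momentumFlip i x) (pairPath ω)) -
          (pinnedChain ω₂ lam β γ).bondCurrent N k ((pinnedChain ω₂ lam β γ).solMap N T T s x (pairPath ω))) ^ 2)
        ∂wienerPair ∂((pinnedChain ω₂ lam β γ).gibbsMeasure N T) ≤ ENNReal.ofReal B₂) :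
    (∫ x, (pinnedChain ω₂ lam β γ).bondCurrent N i x *
        (∫ y, (pinnedChain ω₂ lam β γ).bondCurrent N k y ∂((pinnedChain ω₂ lam β γ).transitionKernel N T T s x))
        ∂((pinnedChain ω₂ lam β γ).gibbsMeasure N T)) ^ 2 ≤
      (∫ x, (pinnedChain ω₂ lam β γ).bondCurrent N i x ^ 2 ∂((pinnedChain ω₂ lam β γ).gibbsMeasure N T)) *
        (2 * B₁ + 2 * B₂) / 4 := by
  have hN0 : 0 < N := k.pos
  set P := pinnedChain ω₂ lam β γ with hP
  set μ := P.gibbsMeasure N T with hμ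
  set κ := P.transitionKernel N T T s with hκ
  set h : PhaseSpace N → ℝ := fun x => ∫ y, P.bondCurrent N k y ∂(κ x) with hh
  -- `L²(μ_T)` membership of `j_i` and of `κ_s j_k`
  obtain ⟨hϑ0, h2ϑ⟩ := quarter_inv_temp_admissible hT
  have hji := pinnedChain_integral_sq_act_le hω hl.le hβ hγ hN0 hT hϑ0 h2ϑ
    (pinnedChain_continuous_bondCurrent ω₂ lam β γ N i) (pinnedChain_abs_bondCurrent_le_exp hω.le hl.le hβ.le γ N hϑ0 i) s
  have hjk := pinnedChain_integral_sq_act_le hω hl.le hβ hγ hN0 hT hϑ0 h2ϑ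
    (pinnedChain_continuous_bondCurrent ω₂ lam β γ N k) (pinnedChain_abs_bondCurrent_le_exp hω.le hl.le hβ.le γ N hϑ0 k) s
  have hj2 : MemLp (P.bondCurrent N i) 2 μ :=
    (memLp_two_iff_integrable_sq (pinnedChain_continuous_bondCurrent ω₂ lam β γ N i).aestronglyMeasurable).2 hji.1
  have hhm : StronglyMeasurable h :=
    (pinnedChain_continuous_bondCurrent ω₂ lam β γ N k).stronglyMeasurable.integral_kernel (κ := κ)
  have hh2 : MemLp h 2 μ := (memLp_two_iff_integrable_sq hhm.aestronglyMeasurable).2 hjk.2.1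
  -- the pairing bound for the two-momenta flip
  have hpair := four_mul_sq_integral_le (measurePreserving_contactFlip_gibbsMeasure P N T i i')
    (measurable_contactFlip i i') (contactFlip_involutive i i') (bondCurrent_anchorFlip P i i' hi') hj2 hh2
  -- the dynamic factor
  have hdouble := lintegral_doubleFlip_le (T := T) hω hl hβ hγ i i' k s
  have hB : ∫⁻ x, ∫⁻ ω, ENNReal.ofReal
      ((P.bondCurrent N k (P.solMap N T T s x (pairPath ω)) -
        P.bondCurrent N k (P.solMap N T T s (momentumFlip i (momentumFlip i' x)) (pairPath ω))) ^ 2)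
        ∂wienerPair ∂μ ≤ ENNReal.ofReal (2 * B₁ + 2 * B₂) := by
    refine hdouble.trans ?_
    rw [ENNReal.ofReal_add (by positivity) (by positivity), ENNReal.ofReal_mul (by norm_num),
      ENNReal.ofReal_mul (by norm_num), ENNReal.ofReal_ofNat]
    exact add_le_add (mul_le_mul' le_rfl h₁) (mul_le_mul' le_rfl h₂)
  have hdyn : ∫ x, (h x - h (momentumFlip i (momentumFlip i' x))) ^ 2 ∂μ ≤ 2 * B₁ + 2 * B₂ :=
    integral_sq_kernel_sub_le hω hl hβ hγ hT i i' k s (by positivity) hB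
  have h0 : 0 ≤ ∫ x, P.bondCurrent N i x ^ 2 ∂μ := integral_nonneg fun x => sq_nonneg _
  have h3 := mul_le_mul_of_nonneg_left hdyn h0
  show (∫ x, P.bondCurrent N i x * h x ∂μ) ^ 2 ≤ (∫ x, P.bondCurrent N i x ^ 2 ∂μ) * (2 * B₁ + 2 * B₂) / 4
  linarith

end FlipReduction

open FlipReduction in
/-- **Registered helper `pinnedChain_sq_pairCorrelation_le_of_singleFlips`** (kernel level of stub (C′)
`stub_uniformAnchoredCorrelationTails`, line `series-law-at-every-laplace-frequency`): for the pinned anharmonic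
chain with both baths at temperature `T > 0`, an anchor bond `(i, i+1)`, any bond `k` and any time `s`, the
equilibrium space-time correlation `⟨j_i(0) j_k(s)⟩_{N,T} = ∫ j_i · κ_s j_k dμ_T` satisfies
`⟨j_i(0) j_k(s)⟩² ≤ ¼ ⟨j_i²⟩ (2B₁ + 2B₂)` whenever the pathwise mean squares (under Gibbs ⊗ Wiener, Lebesgue
form) of `j_k` along two strong solutions driven by the SAME Brownian pair, from `x` and from `x` with the single
momentum `p_{i+1}` resp. `p_i` flipped, are `≤ B₁` resp. `≤ B₂` (the flip `Θ_iΘ_{i+1}` preserves `μ_T` and negates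
`j_i`; pairing bound + Jensen in the noise + triangle inequality). [folklore] -/
theorem pinnedChain_sq_pairCorrelation_le_of_singleFlips :
    ∀ ω₂ lam β γ : ℝ, 0 < ω₂ → 0 < lam → 0 < β → 0 < γ → ∀ T : ℝ, 0 < T →
      ∀ (N : ℕ) (i i' k : Fin N), (i' : ℕ) = (i : ℕ) + 1 → ∀ (s : NNReal) (B₁ B₂ : ℝ), 0 ≤ B₁ → 0 ≤ B₂ →
        ∫⁻ x, ∫⁻ ω, ENNReal.ofReal
            (((Literature.MathematicalPhysics.KineticTheory.HeatConduction.pinnedChain ω₂ lam β γ).bondCurrent N k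
                ((Literature.MathematicalPhysics.KineticTheory.HeatConduction.pinnedChain ω₂ lam β γ).solMap N T T s
                  (Literature.MathematicalPhysics.KineticTheory.HeatConduction.momentumFlip i' x)
                  (Literature.Probability.Process.pairPath ω)) -
              (Literature.MathematicalPhysics.KineticTheory.HeatConduction.pinnedChain ω₂ lam β γ).bondCurrent N k
                ((Literature.MathematicalPhysics.KineticTheory.HeatConduction.pinnedChain ω₂ lam β γ).solMap N T T s
                  x (Literature.Probability.Process.pairPath ω))) ^ 2)
            ∂Literature.Probability.Process.wienerPair
            ∂((Literature.MathematicalPhysics.KineticTheory.HeatConduction.pinnedChain ω₂ lam β γ).gibbsMeasure N T) ≤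
          ENNReal.ofReal B₁ →
        ∫⁻ x, ∫⁻ ω, ENNReal.ofReal
            (((Literature.MathematicalPhysics.KineticTheory.HeatConduction.pinnedChain ω₂ lam β γ).bondCurrent N k
                ((Literature.MathematicalPhysics.KineticTheory.HeatConduction.pinnedChain ω₂ lam β γ).solMap N T T s
                  (Literature.MathematicalPhysics.KineticTheory.HeatConduction.momentumFlip i x)
                  (Literature.Probability.Process.pairPath ω)) -
              (Literature.MathematicalPhysics.KineticTheory.HeatConduction.pinnedChain ω₂ lam β γ).bondCurrent N k
                ((Literature.MathematicalPhysics.KineticTheory.HeatConduction.pinnedChain ω₂ lam β γ).solMap N T T s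
                  x (Literature.Probability.Process.pairPath ω))) ^ 2)
            ∂Literature.Probability.Process.wienerPair
            ∂((Literature.MathematicalPhysics.KineticTheory.HeatConduction.pinnedChain ω₂ lam β γ).gibbsMeasure N T) ≤
          ENNReal.ofReal B₂ →
        (∫ x, (Literature.MathematicalPhysics.KineticTheory.HeatConduction.pinnedChain ω₂ lam β γ).bondCurrent N i x *
            (∫ y, (Literature.MathematicalPhysics.KineticTheory.HeatConduction.pinnedChain ω₂ lam β γ).bondCurrent N k y
              ∂((Literature.MathematicalPhysics.KineticTheory.HeatConduction.pinnedChain ω₂ lam β γ).transitionKernel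
                N T T s x))
            ∂((Literature.MathematicalPhysics.KineticTheory.HeatConduction.pinnedChain ω₂ lam β γ).gibbsMeasure N T)) ^ 2 ≤
          (∫ x, (Literature.MathematicalPhysics.KineticTheory.HeatConduction.pinnedChain ω₂ lam β γ).bondCurrent N i x ^ 2
              ∂((Literature.MathematicalPhysics.KineticTheory.HeatConduction.pinnedChain ω₂ lam β γ).gibbsMeasure N T)) *
            (2 * B₁ + 2 * B₂) / 4 :=
  fun _ _ _ _ hω hl hβ hγ _ hT _ i i' k hi' s _ _ hB₁ hB₂ h₁ h₂ =>
    sq_pairCorrelation_le hω hl hβ hγ hT i i' k hi' s hB₁ hB₂ h₁ h₂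

end Summit.AtomisticToContinuum.FouriersLaw.Theorems.AbelThermodynamicLimit.SeriesLawAtEveryLaplaceFrequency

end
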